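import Summits.Langlands.Langlands.Theses.MonodromyRankLadder

/-!
# Route MonodromyRankLadder — Assembly

The assembly item (stmt-Langlands-27785) of the child route `MonodromyRankLadder` (decomp-langlands lens-3 gen 18; `--refines route-Langlands-ParahoricFibre:SmallRangeGenericMonodromy`, edge split, depth 1 — the declared residual T 18195 of the LIVE route ParahoricFibre) for
T = `ParahoricFibre.SmallRangeGenericMonodromy` (stmt-Langlands-18195):
`ConductorRung → DepthRungs → GenericIffRankMaximal → FrobSemisimplificationGeneric → ParahoricFibre.SmallRangeGenericMonodromy`.

This is literally the type of the route file's sorry-free deciding theorem `Summit.Langlands.Langlands.Theses.MonodromyRankLadder.closes`.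
Nothing here proves `Langlands` (nor the parent piece): the assembly records only that the four binders of the route (X₁, X₂ and the two supports J, G), taken together,
imply the parent piece by name.
-/

set_option linter.dupNamespace false -- project-wide option (lakefile weak.linter.dupNamespace); `Summit.Langlands.Langlands` is the mandated namespace

namespace Summit.Langlands.Langlands.Theorems

/-- **Assembly of route MonodromyRankLadder** (stmt-Langlands-27785): `ConductorRung → DepthRungs → GenericIffRankMaximal → FrobSemisimplificationGeneric → ParahoricFibre.SmallRangeGenericMonodromy`.
Proof: unfold `Assembly` and apply the route's deciding theorem `Theses.MonodromyRankLadder.closes`. -/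
theorem monodromyRankLadder_assembly_proof :
    Summit.Langlands.Langlands.Theses.MonodromyRankLadder.Assembly := by
  unfold Summit.Langlands.Langlands.Theses.MonodromyRankLadder.Assembly
  exact Summit.Langlands.Langlands.Theses.MonodromyRankLadder.closes

end Summit.Langlands.Langlands.Theorems
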